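import Mathlib
import Summits.Ventures.PercRepro2.Defs
import Summits.Ventures.PercRepro2.Harris
import Summits.Ventures.PercRepro2.Graph
import Summits.Ventures.PercRepro2.Events
import Summits.Ventures.PercRepro2.TReduction
import Summits.Ventures.PercRepro2.TReductionBase
import Summits.Ventures.PercRepro2.CycleDefs
import Summits.Ventures.PercRepro2.CycleTerm
import Summits.Ventures.PercRepro2.CycleDecode
import Summits.Ventures.PercRepro2.CycleCore
import Summits.Ventures.PercRepro2.AntipodalKleitman
import Summits.Ventures.PercRepro2.CycleBase

/-!
# (T_h) on every cycle (blind cell PercRepro2, mine-a g47)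

**Theorem `t_cycle`**: on the cycle `C_{n+1}` (`CycleDefs.ends`), for every admissible weight vector,
every vertex `h` and every pair of up-sets `𝓤 𝓥` of vertex sets, with `Q = {h ∈ C_0}`,
`U = {C_0 ∈ 𝓤}`, `e = {C_0 ∈ 𝓥}`:

  `P(Q ∩ U) P(e) + P(U) P(Q ∩ e) ≤ P(Q ∩ U ∩ e) + P(Q) P(U ∩ e)`

— the lane's three-event inequality (T_h) (MINE-A.md §95.6, §102) on the first 2-connected infinite
family of graphs (`TFKG` covers forests and triangular cacti; cycles of length `≥ 4` are not FKG).
Proof: `TReductionBase.t_cluster_of_antipodal_base` reduces (T_h) to the antipodal base cases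
`kform Q U e D a ≥ 0` (`a` `0/1`-valued off `D`), `kform_eq_antipodal_sum` writes each as a
2-colouring sum over the configurations supported on `D`; on the cycle the root cluster of a base
configuration is the arc of its closed set `closedSet (baseConfig a D σ) = redSet D σ ∪ pinnedClosed a D`
(`CycleDefs.cluster_eq_arc`), so the sum is the finset sum `Σ_{τ ⊆ D} wtF D F h 𝓤 𝓥 τ` of
`CycleBase` (the red sets `τ = redSet D σ` run over the subsets of `D`), which is nonnegative by
`CycleBase.sum_wtF_nonneg` (the counting core for no pinned-closed edge and `h` inside the hull of
`D`, the comparable Kleitman form otherwise).  No instance, no notation.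
-/

namespace Summit.Ventures.PercRepro2

namespace TCycle

open Finset TReduction

variable {n : ℕ} {R : Type*} [Field R] [LinearOrder R] [IsStrictOrderedRing R]

/-- The edges pinned closed by the weights `a` off `D`. -/
def pinnedClosed (a : Fin (n + 1) → R) (D : Finset (Fin (n + 1))) : Finset (Fin (n + 1)) :=
  univ.filter fun x => x ∉ D ∧ ¬ a x = 1

/-- The red set of a colouring `σ` of `D`: the edges of `D` closed in the first copy. -/
def redSet (D : Finset (Fin (n + 1))) (σ : Config (Fin (n + 1))) : Finset (Fin (n + 1)) :=
  D.filter fun x => σ x = false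

/-- The colouring of `D` with a prescribed red set: open on `D` exactly off `τ`, closed off `D`. -/
def colouring (D τ : Finset (Fin (n + 1))) : Config (Fin (n + 1)) :=
  fun x => decide (x ∈ D ∧ x ∉ τ)

omit [IsStrictOrderedRing R] in
/-- Membership in `pinnedClosed`. -/
lemma mem_pinnedClosed {a : Fin (n + 1) → R} {D : Finset (Fin (n + 1))} {x : Fin (n + 1)} :
    x ∈ pinnedClosed a D ↔ x ∉ D ∧ ¬ a x = 1 := by
  simp [pinnedClosed]

/-- Membership in `redSet`. -/
lemma mem_redSet {D : Finset (Fin (n + 1))} {σ : Config (Fin (n + 1))} {x : Fin (n + 1)} :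
    x ∈ redSet D σ ↔ x ∈ D ∧ σ x = false := by
  simp [redSet]

omit [IsStrictOrderedRing R] in
/-- The closed set of a base configuration: the red set together with the pinned-closed edges. -/
lemma closedSet_baseConfig (a : Fin (n + 1) → R) (D : Finset (Fin (n + 1)))
    (σ : Config (Fin (n + 1))) :
    closedSet (baseConfig a D σ) = redSet D σ ∪ pinnedClosed a D := by
  ext x
  simp only [mem_closedSet, mem_union, mem_redSet, mem_pinnedClosed, baseConfig]
  by_cases hx : x ∈ D
  · simp [hx]
  · simp [hx]

omit [IsStrictOrderedRing R] in
/-- The closed set of the antipode of a base configuration: the blue set together with the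
pinned-closed edges. -/
lemma closedSet_baseConfig_not (a : Fin (n + 1) → R) (D : Finset (Fin (n + 1)))
    (σ : Config (Fin (n + 1))) :
    closedSet (baseConfig a D fun x => !σ x) = (D \ redSet D σ) ∪ pinnedClosed a D := by
  ext x
  simp only [mem_closedSet, mem_union, mem_sdiff, mem_redSet, mem_pinnedClosed, baseConfig]
  by_cases hx : x ∈ D
  · cases σ x <;> simp [hx]
  · simp [hx]

omit [LinearOrder R] [IsStrictOrderedRing R] in
open Classical in
/-- The indicator of the hit event at a configuration, through the arc of its closed set. -/
lemma indicator_hit (h : Fin (n + 1)) (ω : Config (Fin (n + 1))) :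
    (clusterInEvent (ends n) 0 {T : Set (Fin (n + 1)) | h ∈ T}).indicator (fun _ => (1 : R)) ω =
      ((if h ∈ arc (closedSet ω) then (1 : ℤ) else 0 : ℤ) : R) := by
  have hmem : ω ∈ clusterInEvent (ends n) 0 {T : Set (Fin (n + 1)) | h ∈ T} ↔
      h ∈ arc (closedSet ω) := by
    rw [mem_clusterInEvent, Set.mem_setOf_eq, cluster_eq_arc]
  by_cases hh : h ∈ arc (closedSet ω)
  · rw [Set.indicator_of_mem (hmem.2 hh), if_pos hh]; simp
  · rw [Set.indicator_of_notMem (fun hc => hh (hmem.1 hc)), if_neg hh]; simp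

omit [LinearOrder R] [IsStrictOrderedRing R] in
open Classical in
/-- The indicator of a cluster event at a configuration, through the arc of its closed set. -/
lemma indicator_clusterIn (𝓤 : Set (Set (Fin (n + 1)))) (ω : Config (Fin (n + 1))) :
    (clusterInEvent (ends n) 0 𝓤).indicator (fun _ => (1 : R)) ω =
      ((if arc (closedSet ω) ∈ 𝓤 then (1 : ℤ) else 0 : ℤ) : R) := by
  have hmem : ω ∈ clusterInEvent (ends n) 0 𝓤 ↔ arc (closedSet ω) ∈ 𝓤 := by
    rw [mem_clusterInEvent, cluster_eq_arc]
  by_cases hh : arc (closedSet ω) ∈ 𝓤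
  · rw [Set.indicator_of_mem (hmem.2 hh), if_pos hh]; simp
  · rw [Set.indicator_of_notMem (fun hc => hh (hmem.1 hc)), if_neg hh]; simp

omit [IsStrictOrderedRing R] in
/-- **The summand of the antipodal base case is the finset term `wtF`** at the red set. -/
lemma summand_eq_wtF (a : Fin (n + 1) → R) (D : Finset (Fin (n + 1))) (h : Fin (n + 1))
    (𝓤 𝓥 : Set (Set (Fin (n + 1)))) (σ : Config (Fin (n + 1))) :
    (clusterInEvent (ends n) 0 {T : Set (Fin (n + 1)) | h ∈ T}).indicator (fun _ => (1 : R))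
        (baseConfig a D σ)
      * ((clusterInEvent (ends n) 0 𝓤).indicator (fun _ => (1 : R)) (baseConfig a D σ)
          - (clusterInEvent (ends n) 0 𝓤).indicator (fun _ => (1 : R))
              (baseConfig a D fun x => !σ x))
      * ((clusterInEvent (ends n) 0 𝓥).indicator (fun _ => (1 : R)) (baseConfig a D σ)
          - (clusterInEvent (ends n) 0 𝓥).indicator (fun _ => (1 : R))
              (baseConfig a D fun x => !σ x)) =
      ((wtF D (pinnedClosed a D) h 𝓤 𝓥 (redSet D σ) : ℤ) : R) := by
  rw [indicator_hit, indicator_clusterIn, indicator_clusterIn, indicator_clusterIn,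
    indicator_clusterIn, closedSet_baseConfig, closedSet_baseConfig_not]
  unfold wtF
  push_cast
  ring

/-- `redSet` maps the colourings supported on `D` into the subsets of `D`. -/
lemma redSet_mem_powerset (D : Finset (Fin (n + 1))) (σ : Config (Fin (n + 1))) :
    redSet D σ ∈ D.powerset :=
  mem_powerset.2 (filter_subset _ _)

/-- `colouring` maps the subsets of `D` into the colourings supported on `D`. -/
lemma colouring_mem_suppOn (D τ : Finset (Fin (n + 1))) : colouring D τ ∈ suppOn D := by
  rw [mem_suppOn]
  intro x hx
  simp [colouring, hx]

/-- `colouring` inverts `redSet` on the colourings supported on `D`. -/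
lemma colouring_redSet {D : Finset (Fin (n + 1))} {σ : Config (Fin (n + 1))}
    (hσ : σ ∈ suppOn D) : colouring D (redSet D σ) = σ := by
  rw [mem_suppOn] at hσ
  funext x
  by_cases hx : x ∈ D
  · cases hσx : σ x <;> simp [colouring, redSet, hx, hσx]
  · simp [colouring, hx, hσ x hx]

/-- `redSet` inverts `colouring` on the subsets of `D`. -/
lemma redSet_colouring {D τ : Finset (Fin (n + 1))} (hτ : τ ∈ D.powerset) :
    redSet D (colouring D τ) = τ := by
  rw [mem_powerset] at hτ
  ext x
  simp only [mem_redSet, colouring]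
  constructor
  · rintro ⟨hxD, hx⟩
    by_contra hxτ
    simp [hxD, hxτ] at hx
  · intro hx
    exact ⟨hτ hx, by simp [hτ hx, hx]⟩

/-- **Every antipodal base case of the cycle is nonnegative** (the hypothesis of
`t_cluster_of_antipodal_base`). -/
theorem kform_nonneg (h : Fin (n + 1)) {𝓤 𝓥 : Set (Set (Fin (n + 1)))} (hU : IsUpperSet 𝓤)
    (hV : IsUpperSet 𝓥) (D : Finset (Fin (n + 1))) (a : Fin (n + 1) → R)
    (ha : ∀ x, x ∉ D → a x = 0 ∨ a x = 1) :
    0 ≤ kform (clusterInEvent (ends n) 0 {T : Set (Fin (n + 1)) | h ∈ T})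
      (clusterInEvent (ends n) 0 𝓤) (clusterInEvent (ends n) 0 𝓥) D a := by
  rw [kform_eq_antipodal_sum _ _ _ ha]
  rw [sum_congr rfl fun σ _ => summand_eq_wtF a D h 𝓤 𝓥 σ]
  have hre : ∑ σ ∈ suppOn D, ((wtF D (pinnedClosed a D) h 𝓤 𝓥 (redSet D σ) : ℤ) : R) =
      ((∑ τ ∈ D.powerset, wtF D (pinnedClosed a D) h 𝓤 𝓥 τ : ℤ) : R) := by
    rw [Int.cast_sum]
    exact sum_nbij' (redSet D) (colouring D) (fun σ _ => redSet_mem_powerset D σ)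
      (fun τ _ => colouring_mem_suppOn D τ) (fun σ hσ => colouring_redSet hσ)
      (fun τ hτ => redSet_colouring hτ) (fun _ _ => rfl)
  rw [hre]
  exact Int.cast_nonneg (sum_wtF_nonneg hU hV)

/-- **(T_h) on every cycle**: for admissible weights on the cycle `C_{n+1}`, a vertex `h` and up-sets
`𝓤 𝓥` of vertex sets, with `Q = {h ∈ C_0}`, `U = {C_0 ∈ 𝓤}`, `e = {C_0 ∈ 𝓥}`,
`P(Q ∩ U) P(e) + P(U) P(Q ∩ e) ≤ P(Q ∩ U ∩ e) + P(Q) P(U ∩ e)`. -/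
theorem t_cycle (p : Fin (n + 1) → R) (hp : IsProbVec p) (h : Fin (n + 1))
    {𝓤 𝓥 : Set (Set (Fin (n + 1)))} (hU : IsUpperSet 𝓤) (hV : IsUpperSet 𝓥) :
    prob p (clusterInEvent (ends n) 0 {T : Set (Fin (n + 1)) | h ∈ T} ∩ clusterInEvent (ends n) 0 𝓤)
        * prob p (clusterInEvent (ends n) 0 𝓥)
      + prob p (clusterInEvent (ends n) 0 𝓤)
        * prob p (clusterInEvent (ends n) 0 {T : Set (Fin (n + 1)) | h ∈ T}
            ∩ clusterInEvent (ends n) 0 𝓥) ≤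
      prob p (clusterInEvent (ends n) 0 {T : Set (Fin (n + 1)) | h ∈ T}
          ∩ clusterInEvent (ends n) 0 𝓤 ∩ clusterInEvent (ends n) 0 𝓥)
        + prob p (clusterInEvent (ends n) 0 {T : Set (Fin (n + 1)) | h ∈ T})
          * prob p (clusterInEvent (ends n) 0 𝓤 ∩ clusterInEvent (ends n) 0 𝓥) :=
  t_cluster_of_antipodal_base p hp (ends n) 0 h 𝓤 𝓥 fun D a _ ha => kform_nonneg h hU hV D a ha

end TCycle

end Summit.Ventures.PercRepro2
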